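import Summits.AtomisticToContinuum.FouriersLaw.Theses.BoundaryEscapeDeficit

/-!
# Birth skeleton for crux `ResponseIdentity` (stmt-AtomisticToContinuum-12237), route `BoundaryEscapeDeficit`

Sub-problem `FouriersLaw`; crux r4 `ResponseIdentity` = the RESPONSE IDENTITY IN ESCAPE-DEFICIT (AUTO) FORM: for
`P = pinnedChain ω₂ lam β γ` (all four `> 0`), ASSUMING weak-NESS uniqueness, along every steady-state family `μ`,
for every `T > 0` and every `N ≥ 1`: the near kinetic kernel `K_N(u) = ∫ (p_0² - T)·P_u(p_0² - T) dμ_T` is in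
`L¹(0,∞)` and `totalCurrent(μ N (T+δ/2) (T-δ/2))/δ → (N-1)·γ·E_N` as `δ → 0`, `δ ≠ 0`, `E_N = 1 - (γ/T²)∫_{u>0} K_N`.

(The crux directory `Cruxes/ResponseIdentity/` is SHARED with the homonymous crux of route `GriffithsLimitExchange`,
stmt-AtomisticToContinuum-13202, whose registered skeleton is `Lines/birth.lean`; this file is therefore published as
`Lines/birth_BoundaryEscapeDeficit.lean` and lives in its own namespace `…Cruxes.ResponseIdentity.EscapeBirth`.)

## The line: CROSS-FORM KUBO + NEAR-CONTACT SUM RULE ("the conductance is what fails to come back") — two stubs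

Write `A_M(u) = ∫ (p_0² - T)·P_u(p_0² - T) dμ_T` (near kernel = the crux's `K_{M+1}`) and
`C_M(u) = ∫ p_0²·P_u p_M² dμ_T - (∫ p_0² dμ_T)(∫ P_u p_M² dμ_T)` (cross / contact-to-contact power covariance) for the
`(M+1)`-site equilibrium chain (`P_u = P.transitionKernel (M+1) T T u⁺`, `μ_T = P.gibbsMeasure (M+1) T`, both CONSTRUCTED).

* `stub_crossFormKubo` (size L) — the fixed-`N` CROSS-FORM boundary Kubo limit along the family:
  `totalCurrent(μ (M+1) (T+δ/2) (T-δ/2))/δ → M·(γ²/T²)·∫_{u>0} C_M(u) du`. Content: finite-`N` linear response AT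
  EQUILIBRIUM for the hypoelliptic Langevin chain (Gibbs-tested transient time-correlation identity, Harris bounds
  locally uniform in the bath temperatures, energy balance `totalCurrent = Mγ(⟨p_M²⟩ - T_R)`). This is verbatim the
  `Tendsto` clause of the sibling crux `PhononMeanFreePath.BoundaryKubo` (stmt-AtomisticToContinuum-11812), LANDED as
  `Theorems/PhononMeanFreePathBoundaryKubo.lean :: boundaryKubo_proof` (discharge: `(boundaryKubo_proof … hT M).2`).
* `stub_escapeSumRule` (size M) — the ZEROTH-MOMENT (energy-balance) SUM RULE at the NEAR contact, with the
  integrability it needs: `A_M ∈ L¹(0,∞)` and `∫_{u>0} A_M + ∫_{u>0} C_M = T²/γ`. Content: Dynkin for `H` along the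
  constructed kernels (`LH = -γ((p_0² - T) + (p_M² - T))`), paired with `p_0² - T` under the invariant Gibbs measure,
  Stein `∫ (p_0² - T)·H dμ_T = T²`, and exponential mixing at fixed size (`∫ (p_0² - T)·P_r H dμ_T → 0`, `A_M, C_M ∈ L¹`).
  LANDED as `Theorems/PhononMeanFreePathIncoherentBoundedSumRule.lean :: IncoherentBounded.sumRule` and
  `IncoherentBounded.kinCorr_integrableOn … 0 0` (discharge: `⟨kinCorr_integrableOn hω hl.le hβ hγ (Nat.succ_pos M) hT 0 0,
  sumRule hω hl.le hβ hγ hT M⟩`).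
* `ResponseIdentity_of` — the composition, kernel-checked here (no `sorry`): `N = M + 1`; the crux's `K_{M+1}` is `A_M`
  (`⟨0,_⟩ = 0`); integrability from stub 2; the sum rule turns the crux's value `((M+1)-1)·γ·(1 - (γ/T²)∫A_M)` into the
  cross-form value `M·(γ²/T²)·∫C_M` delivered by stub 1.

STATUS (2026-08-17): both stubs are landed, and the crux itself is ALREADY PROVED in the tree:
`Summit.AtomisticToContinuum.FouriersLaw.Cruxes.SuperadditiveResistance.ThermaliseThenCutProbeInsertion.responseIdentity_proof
: BoundaryEscapeDeficit.ResponseIdentity` (`Theorems/JunctionLocalitySuperadditiveResistanceStubLinearResponsePlain.lean`,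
= `IncoherentBounded.boundaryKubo_iff_responseIdentity.mp boundaryKubo_proof`). Item stmt-12237 should be closed
`--as proved --by` that declaration; this skeleton records the two-piece structure of that proof for the re-audit.

## Disproof used
No `Cruxes/ResponseIdentity/Disproof.lean` exists. Honoured load-bearing hypotheses (sibling's
`BoundaryKubo.Negative.LoadBearing`: `limitClause_false_without_steady`, `limitClause_false_without_T_pos`): the steady
family and `T > 0` are carried by `stub_crossFormKubo` and by the crux; `N ≥ 1` is the crux's own guard (empty chain
excluded; `M + 1 = 1`: both sides `0`, `C_0 = A_0`, sum rule `2∫A_0 = T²/γ`). `ledger negatives --problem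
AtomisticToContinuum`: no FouriersLaw statement refuted; no landed Negative lemma refutes an instance of either stub.
-/

noncomputable section

open MeasureTheory Filter Topology Set
open scoped NNReal

namespace Summit.AtomisticToContinuum.FouriersLaw.Cruxes.ResponseIdentity.EscapeBirth

open Literature.MathematicalPhysics.KineticTheory.HeatConduction
open Summit.AtomisticToContinuum.FouriersLaw.Theses.BoundaryEscapeDeficit (ResponseIdentity)

/-! ### The registered stubs (`sorry` lives ONLY here) -/

/-- STUB 1 `stub_crossFormKubo` (size L; landed) — CROSS-FORM BOUNDARY KUBO LIMIT for the `(M+1)`-site chain under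
weak-NESS uniqueness, along any steady-state family: `totalCurrent(μ (M+1) (T+δ/2) (T-δ/2))/δ → M·(γ²/T²)·∫_{u>0} C_M`
with `C_M(u) = μ_T(p_0²·P_u p_M²) - μ_T(p_0²)·μ_T(P_u p_M²)`. Verbatim the `Tendsto` clause of
`PhononMeanFreePath.BoundaryKubo` (stmt-AtomisticToContinuum-11812), proved in `Theorems/PhononMeanFreePathBoundaryKubo.lean`
(`boundaryKubo_proof`). [cite: KunduDharNarayan2009] [cite: CuneoEckmannHairerReyBellet2018, Thm 2.13] -/
theorem stub_crossFormKubo :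
    ∀ ω₂ lam β γ : ℝ, 0 < ω₂ → 0 < lam → 0 < β → 0 < γ →
      (∀ (N : ℕ) (T_L T_R : ℝ), 0 < T_L → 0 < T_R → ∀ μ ν : Measure (PhaseSpace N),
          (pinnedChain ω₂ lam β γ).IsSteadyState N T_L T_R μ →
            (pinnedChain ω₂ lam β γ).IsSteadyState N T_L T_R ν → μ = ν) →
        ∀ μ : (N : ℕ) → ℝ → ℝ → Measure (PhaseSpace N),
          (∀ (N : ℕ) (T_L T_R : ℝ), 0 < T_L → 0 < T_R →
              (pinnedChain ω₂ lam β γ).IsSteadyState N T_L T_R (μ N T_L T_R)) →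
            ∀ T : ℝ, 0 < T → ∀ M : ℕ,
              Tendsto (fun δ : ℝ =>
                  (pinnedChain ω₂ lam β γ).totalCurrent (μ (M + 1) (T + δ / 2) (T - δ / 2)) / δ)
                (𝓝[≠] 0)
                (𝓝 ((M : ℝ) * (γ ^ 2 / T ^ 2) * ∫ t in Ioi (0 : ℝ),
                  ((∫ z, (z.2 0) ^ 2 * (∫ y, (y.2 (Fin.last M)) ^ 2
                      ∂((pinnedChain ω₂ lam β γ).transitionKernel (M + 1) T T t.toNNReal z))
                      ∂((pinnedChain ω₂ lam β γ).gibbsMeasure (M + 1) T)) -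
                    (∫ z, (z.2 0) ^ 2 ∂((pinnedChain ω₂ lam β γ).gibbsMeasure (M + 1) T)) *
                      (∫ z, (∫ y, (y.2 (Fin.last M)) ^ 2
                        ∂((pinnedChain ω₂ lam β γ).transitionKernel (M + 1) T T t.toNNReal z))
                        ∂((pinnedChain ω₂ lam β γ).gibbsMeasure (M + 1) T))))) := by
  sorry

/-- STUB 2 `stub_escapeSumRule` (size M; landed) — ZEROTH-MOMENT SUM RULE AT THE NEAR CONTACT, with integrability:
for the `(M+1)`-site chain at `T > 0`, the near kinetic kernel `A_M(u) = ∫ (p_0² - T)·P_u(p_0² - T) dμ_T` is integrable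
on `(0,∞)` and `∫_{u>0} A_M + ∫_{u>0} C_M = T²/γ` (`C_M` the cross power covariance of stub 1): a spontaneous
fluctuation of the boundary kinetic energy is, in the time integral, either re-absorbed by the near bath (`A`) or
transmitted to the far contact (`C`) — energy balance `LH = -γ((p_0² - T) + (p_M² - T))` integrated along the
equilibrium dynamics (Dynkin for `H`, Stein `∫ (p_0² - T)H dμ_T = T²`, exponential mixing at fixed size). Verbatim
`IncoherentBounded.kinCorr_integrableOn … 0 0` ∧ `IncoherentBounded.sumRule`
(`Theorems/PhononMeanFreePathIncoherentBoundedSumRule.lean`). [cite: KunduDharNarayan2009, arXiv:0809.4543 p. 3]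
[cite: CuneoEckmannHairerReyBellet2018, Thm 2.13 (3)] -/
theorem stub_escapeSumRule :
    ∀ ω₂ lam β γ : ℝ, 0 < ω₂ → 0 < lam → 0 < β → 0 < γ → ∀ T : ℝ, 0 < T → ∀ M : ℕ,
      IntegrableOn (fun u : ℝ => ∫ z, (z.2 0 ^ 2 - T) * (∫ y, (y.2 0 ^ 2 - T)
          ∂((pinnedChain ω₂ lam β γ).transitionKernel (M + 1) T T u.toNNReal z))
          ∂((pinnedChain ω₂ lam β γ).gibbsMeasure (M + 1) T)) (Ioi 0) ∧
      (∫ t in Ioi (0 : ℝ), ∫ z, (z.2 0 ^ 2 - T) * (∫ y, (y.2 0 ^ 2 - T)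
          ∂((pinnedChain ω₂ lam β γ).transitionKernel (M + 1) T T t.toNNReal z))
          ∂((pinnedChain ω₂ lam β γ).gibbsMeasure (M + 1) T)) +
        ∫ t in Ioi (0 : ℝ), ((∫ z, (z.2 0) ^ 2 * (∫ y, (y.2 (Fin.last M)) ^ 2
            ∂((pinnedChain ω₂ lam β γ).transitionKernel (M + 1) T T t.toNNReal z))
            ∂((pinnedChain ω₂ lam β γ).gibbsMeasure (M + 1) T)) -
          (∫ z, (z.2 0) ^ 2 ∂((pinnedChain ω₂ lam β γ).gibbsMeasure (M + 1) T)) *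
            (∫ z, (∫ y, (y.2 (Fin.last M)) ^ 2
              ∂((pinnedChain ω₂ lam β γ).transitionKernel (M + 1) T T t.toNNReal z))
              ∂((pinnedChain ω₂ lam β γ).gibbsMeasure (M + 1) T))) =
        T ^ 2 / γ := by
  sorry

/-! ### By-name statements of the registered stubs

The skeleton audit wants the hypotheses of the crux-concluding theorem to be the declared stubs BY NAME;
`Registered.stub_x` is DEFINITIONALLY the statement of the sorried `theorem stub_x` (`type_of%`), so
`ResponseIdentity_of : Registered.stub_crossFormKubo → Registered.stub_escapeSumRule → ResponseIdentity` is literally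
"stub signatures → crux". -/

namespace Registered

/-- Statement of registered stub 1 (`stub_crossFormKubo`), by name. -/
def stub_crossFormKubo : Prop := type_of% EscapeBirth.stub_crossFormKubo

/-- Statement of registered stub 2 (`stub_escapeSumRule`), by name. -/
def stub_escapeSumRule : Prop := type_of% EscapeBirth.stub_escapeSumRule

end Registered

/-! ### The composition (kernel-checked, no `sorry`): the two stubs give the crux BY NAME -/

/-- `stub_crossFormKubo → stub_escapeSumRule → ResponseIdentity`: write `N = M + 1`; the crux's near kernel `K_{M+1}`
is `A_M` (indices `⟨0,_⟩ = 0`), so integrability is the first half of stub 2; the sum rule `∫A_M + ∫C_M = T²/γ` rewrites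
the crux's limit value `((M+1)-1)·γ·(1 - (γ/T²)∫A_M)` as the cross-form value `M·(γ²/T²)·∫C_M` of stub 1. [folklore] -/
theorem ResponseIdentity_of (h1 : Registered.stub_crossFormKubo) (h2 : Registered.stub_escapeSumRule) :
    ResponseIdentity := by
  intro ω₂ lam β γ hω hl hβ hγ huniq μ hμ T hT
  dsimp only
  intro N hN
  obtain ⟨M, rfl⟩ : ∃ M, N = M + 1 := ⟨N - 1, by omega⟩
  -- the crux's near kernel at `M + 1` sites is `A_M`, pointwise
  have hK : ∀ u : ℝ,
      (if h : 0 < M + 1 then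
          ∫ z, ((z.2 ⟨0, h⟩) ^ 2 - T) * (∫ y, ((y.2 ⟨0, h⟩) ^ 2 - T)
            ∂((pinnedChain ω₂ lam β γ).transitionKernel (M + 1) T T u.toNNReal z))
            ∂((pinnedChain ω₂ lam β γ).gibbsMeasure (M + 1) T)
        else 0) =
        ∫ z, (z.2 0 ^ 2 - T) * (∫ y, (y.2 0 ^ 2 - T)
          ∂((pinnedChain ω₂ lam β γ).transitionKernel (M + 1) T T u.toNNReal z))
          ∂((pinnedChain ω₂ lam β γ).gibbsMeasure (M + 1) T) := by
    intro u
    rw [dif_pos (Nat.succ_pos M)]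
    rfl
  obtain ⟨hInt, hSum⟩ := h2 ω₂ lam β γ hω hl hβ hγ T hT M
  have hlim := h1 ω₂ lam β γ hω hl hβ hγ huniq μ hμ T hT M
  simp only [hK]
  refine ⟨hInt, ?_⟩
  have hT0 : T ≠ 0 := hT.ne'
  have hγ0 : γ ≠ 0 := hγ.ne'
  -- the sum rule identifies the escape-deficit value with the cross-form Kubo value
  have hval : (((M + 1 : ℕ) : ℝ) - 1) * γ * (1 - γ / T ^ 2 * ∫ t in Ioi (0 : ℝ), ∫ z, (z.2 0 ^ 2 - T) *
        (∫ y, (y.2 0 ^ 2 - T) ∂((pinnedChain ω₂ lam β γ).transitionKernel (M + 1) T T t.toNNReal z))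
        ∂((pinnedChain ω₂ lam β γ).gibbsMeasure (M + 1) T)) =
      (M : ℝ) * (γ ^ 2 / T ^ 2) * ∫ t in Ioi (0 : ℝ),
        ((∫ z, (z.2 0) ^ 2 * (∫ y, (y.2 (Fin.last M)) ^ 2
            ∂((pinnedChain ω₂ lam β γ).transitionKernel (M + 1) T T t.toNNReal z))
            ∂((pinnedChain ω₂ lam β γ).gibbsMeasure (M + 1) T)) -
          (∫ z, (z.2 0) ^ 2 ∂((pinnedChain ω₂ lam β γ).gibbsMeasure (M + 1) T)) *
            (∫ z, (∫ y, (y.2 (Fin.last M)) ^ 2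
              ∂((pinnedChain ω₂ lam β γ).transitionKernel (M + 1) T T t.toNNReal z))
              ∂((pinnedChain ω₂ lam β γ).gibbsMeasure (M + 1) T))) := by
    rw [← eq_sub_iff_add_eq'] at hSum
    rw [hSum]
    push_cast
    field_simp
    ring
  rw [hval]
  exact hlim

end Summit.AtomisticToContinuum.FouriersLaw.Cruxes.ResponseIdentity.EscapeBirth

end
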